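import Mathlib
import HarnessLib
import Summits.Ventures.LatticeQCDFlow.Scaling.TorusRankedMorseStructure

/-!
# LatticeQCDFlow / Scaling — a top-link assignment is RANKABLE iff its dependency digraph is acyclic

HONEST FRAMING: exact (Metropolis-corrected) sampling algorithms for lattice gauge theory;
figures of merit are autocorrelation/cost numbers at stated couplings and volumes; no
continuum-physics claim.

Venture `LatticeQCDFlow` (cell pub-lqcd), topic `Scaling`, FANOUT row 30 (lean-1, GEN-25) — OUR WORK on
THEORY-2.md §4 row C5.  Every exactness / counting statement of the heat-bath lineage
(`Scaling/AutoregressiveGaugeHeatBathRanked`, `TorusRankedParityBound`, `TorusRankedHomologyBound`,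
`TorusRankedMorseStructure`, …) is hypothesised on a RANK function: `rank p < rank p'` whenever the top
link `t p` of `p ∈ B` lies on another `p' ∈ B`.  Seats searching for structures (the GEN-24 heuristics,
the planners) check a digraph instead, and the engines need a generation ORDER.  This file records the
equivalences:

* §1 **`exists_rank_of_acyclic`** — a relation `R` on a finite type with no cycle
  (`¬ TransGen R a a` for all `a`) admits a height function `rank` with `R a b → rank a < rank b`
  (`rank b` = the number of strict `R`-ancestors of `b`); **`acyclic_of_rank`** — the converse;
* §2 the plaquette form **`exists_rank_iff_acyclic`**: for `B`, `t` on `(ℤ/L)^d`, a rank function as in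
  the lineage's hypotheses exists iff the dependency digraph `p → p'` (`p ≠ p'` in `B`, `t p` a link of
  `p'`) has no directed cycle;
* §3 **`exists_rank_iff_injOn_and_exists_order`** — equivalently (`t p` a link of `p` on `B`): `t` is
  injective on `B` AND a compatible generation order exists (a duplicate-free list of all links in which
  the three other links of every `p ∈ B` precede `t p`; `PlaquetteTopLinkOrders.exists_order_of_topLink_rank`
  one way, `rank p :=` the position of `t p` the other; injectivity from `injOn_of_ranked`).

No `def`, no `sorry`, nothing cited as a fact beyond the tree.
-/

namespace Summit.Ventures.LatticeQCDFlow.Theory2.Autoregressive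

open Finset
open Literature.MathematicalPhysics.QuantumFieldTheory

/-! ## §1 Finite acyclic relations have height functions -/

/-- **A relation without cycles on a finite type has a height function**: with
`rank b = #{a | TransGen R a b}`, `R a b` gives `rank a < rank b` (the ancestors of `a` are ancestors of
`b`, and `a` itself is an ancestor of `b` but not of `a`). [folklore] -/
theorem exists_rank_of_acyclic {α : Type*} [Fintype α] (R : α → α → Prop)
    (hacyc : ∀ a, ¬ Relation.TransGen R a a) :
    ∃ rank : α → ℕ, ∀ a b, R a b → rank a < rank b := by
  classical
  refine ⟨fun b => (Finset.univ.filter fun a => Relation.TransGen R a b).card, fun a b hab => ?_⟩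
  apply Finset.card_lt_card
  rw [Finset.ssubset_iff_of_subset]
  · refine ⟨a, ?_, ?_⟩
    · exact Finset.mem_filter.2 ⟨Finset.mem_univ _, Relation.TransGen.single hab⟩
    · exact fun h => hacyc a (Finset.mem_filter.1 h).2
  · intro c hc
    exact Finset.mem_filter.2 ⟨Finset.mem_univ _, (Finset.mem_filter.1 hc).2.tail hab⟩

/-- **Conversely, a height function excludes cycles.** [folklore] -/
theorem acyclic_of_rank {α : Type*} (R : α → α → Prop) (rank : α → ℕ)
    (hrank : ∀ a b, R a b → rank a < rank b) (a : α) : ¬ Relation.TransGen R a a := by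
  have hmono : ∀ x y, Relation.TransGen R x y → rank x < rank y := by
    intro x y h
    induction h with
    | single h => exact hrank _ _ h
    | tail _ h ih => exact ih.trans (hrank _ _ h)
  exact fun h => lt_irrefl _ (hmono a a h)

/-! ## §2 Top-link assignments: rankable iff acyclic -/

/-- **A top-link assignment `t` on `B ⊆` plaquettes of `(ℤ/L)^d` is RANKABLE iff its dependency digraph
is ACYCLIC**: there is `rank` with `rank p < rank p'` whenever `p ≠ p'` lie in `B` and `t p` is a link of
`p'`, iff no directed cycle `p₀ → p₁ → ⋯ → p₀` of such dependencies exists. [ours] -/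
theorem exists_rank_iff_acyclic {d L : ℕ} [NeZero L] (B : Finset (Plaquette d L)) (t : Plaquette d L → Edge d L) :
    (∃ rank : Plaquette d L → ℕ, ∀ p ∈ B, ∀ p' ∈ B, p ≠ p' →
      t p ∈ ({(p'.1, p'.2.1.1), (p'.1.shift p'.2.1.1, p'.2.1.2), (p'.1.shift p'.2.1.2, p'.2.1.1),
        (p'.1, p'.2.1.2)} : Finset (Edge d L)) → rank p < rank p') ↔
    ∀ p, ¬ Relation.TransGen (fun p p' : Plaquette d L => p ∈ B ∧ p' ∈ B ∧ p ≠ p' ∧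
      t p ∈ ({(p'.1, p'.2.1.1), (p'.1.shift p'.2.1.1, p'.2.1.2), (p'.1.shift p'.2.1.2, p'.2.1.1),
        (p'.1, p'.2.1.2)} : Finset (Edge d L))) p p := by
  classical
  constructor
  · rintro ⟨rank, hrank⟩
    exact acyclic_of_rank _ rank (fun a b h => hrank a h.1 b h.2.1 h.2.2.1 h.2.2.2)
  · intro hacyc
    obtain ⟨rank, hrank⟩ := exists_rank_of_acyclic _ hacyc
    exact ⟨rank, fun p hp p' hp' hne hmem => hrank p p' ⟨hp, hp', hne, hmem⟩⟩

/-! ## §3 Rankable iff injective with a compatible generation order -/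

/-- **A compatible generation order with an injective assignment yields a rank**: `rank p :=` the position
of `t p` in the list. [ours] -/
theorem exists_rank_of_compatible_order {d L : ℕ} (B : Finset (Plaquette d L))
    (t : Plaquette d L → Edge d L) (hinj : Set.InjOn t B) (l : List (Edge d L))
    (hl : ∀ p ∈ B, ∀ e' ∈ ({(p.1, p.2.1.1), (p.1.shift p.2.1.1, p.2.1.2),
        (p.1.shift p.2.1.2, p.2.1.1), (p.1, p.2.1.2)} : Finset (Edge d L)), e' ≠ t p → l.idxOf e' < l.idxOf (t p)) :
    ∃ rank : Plaquette d L → ℕ, ∀ p ∈ B, ∀ p' ∈ B, p ≠ p' →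
      t p ∈ ({(p'.1, p'.2.1.1), (p'.1.shift p'.2.1.1, p'.2.1.2), (p'.1.shift p'.2.1.2, p'.2.1.1),
        (p'.1, p'.2.1.2)} : Finset (Edge d L)) → rank p < rank p' :=
  ⟨fun p => l.idxOf (t p), fun p hp p' hp' hne hmem =>
    hl p' hp' (t p) hmem (fun h => hne (hinj hp hp' h))⟩

/-- **RANKABLE ⇔ INJECTIVE WITH A COMPATIBLE ORDER** (`t p` a link of `p` for `p ∈ B`): a rank function exists
iff `t` is injective on `B` and some duplicate-free list of all links puts, for every `p ∈ B`, the three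
other links of `p` before `t p` — the implementability datum of the ancestral sampler. [ours] -/
theorem exists_rank_iff_injOn_and_exists_order {d L : ℕ} [NeZero L] (B : Finset (Plaquette d L))
    (t : Plaquette d L → Edge d L)
    (ht : ∀ p ∈ B, t p ∈ ({(p.1, p.2.1.1), (p.1.shift p.2.1.1, p.2.1.2),
        (p.1.shift p.2.1.2, p.2.1.1), (p.1, p.2.1.2)} : Finset (Edge d L))) :
    (∃ rank : Plaquette d L → ℕ, ∀ p ∈ B, ∀ p' ∈ B, p ≠ p' →
      t p ∈ ({(p'.1, p'.2.1.1), (p'.1.shift p'.2.1.1, p'.2.1.2), (p'.1.shift p'.2.1.2, p'.2.1.1),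
        (p'.1, p'.2.1.2)} : Finset (Edge d L)) → rank p < rank p') ↔
    Set.InjOn t B ∧ ∃ l : List (Edge d L), l.Nodup ∧ (∀ e : Edge d L, e ∈ l) ∧
      ∀ p ∈ B, ∀ e' ∈ ({(p.1, p.2.1.1), (p.1.shift p.2.1.1, p.2.1.2),
          (p.1.shift p.2.1.2, p.2.1.1), (p.1, p.2.1.2)} : Finset (Edge d L)),
        e' ≠ t p → l.idxOf e' < l.idxOf (t p) := by
  constructor
  · rintro ⟨rank, hrank⟩
    have hinj := injOn_of_ranked B t ht rank hrank
    exact ⟨hinj, exists_order_of_topLink_rank B t hinj rank hrank⟩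
  · rintro ⟨hinj, l, -, -, hl⟩
    exact exists_rank_of_compatible_order B t hinj l hl

end Summit.Ventures.LatticeQCDFlow.Theory2.Autoregressive
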